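import Literature.MathematicalPhysics.QuantumFieldTheory.Balaban1983to89.B9Thm311SmallFieldClosed
import Literature.MathematicalPhysics.QuantumFieldTheory.Balaban1983to89.B9Eq326OperatorTowerFlat
import Literature.MathematicalPhysics.QuantumFieldTheory.Balaban1983to89.B9Eq319QprimeTowerCentre

/-!
# `Balaban1983to89.B9Thm311SmallFieldCoercivityTower` — T. Bałaban, *Propagators for lattice gauge theories in a background field*, Commun.
# Math. Phys. **99** (1985) 389–434 [Balaban1985BackgroundPropagators] Thm 3.11 p. 416 with (3.82)–(3.86) p. 407, AT `k = n+1` AVERAGING LEVELS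
# AND A FIXED LATTICE: THE `k`-LEVEL PRINCIPAL GAUGE-FIXED OPERATOR `D*D + D R(U) D* + a Q_k(U)* Q_k(U)` (composite averagings (3.15)/(3.19))
# IS COERCIVE AT EVERY SMALL FIELD — E′ = `B9Thm311SmallFieldCoercivity` ONE STOREY UP: the flat constant from `B9Eq326OperatorTowerFlat`, the
# `D`, `D*`, `D*D`, `Δ^η_U` and `R(U)` remainders PROVED (fine-lattice letters), the two TOWER averaging remainders (`Q′_k(U)`, `Q_k(U)` vs flat)
# and a right inverse of `Q′_k` DISPLAYED

statement-level skeleton of published theorems with citation tags; proofs where landed; nothing here is a claim about the Yang–Mills mass gap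

CITATION HEADER (lean-in-tree rule).  Audit cell `pub-balaban`, sub-cell `t4`, BINDER row NE9; filed by the row OWNER lineage `b2b-balaban-t4-ne9-p1`
(gen 83).  Sources READ by this lineage in the held texts: [Balaban1985BackgroundPropagators] pp. 393–395, 404–407, 416
(`paper:balaban1985-cmp99-background-propagators`, journal page = PDF page + 388); [Balaban1984PropagatorsI] p. 30.

THE PRINT (verbatim).  p. 416: *«Theorem 3.11. Under the assumptions of the Theorems 3.1–3.10 (i.e. for M sufficiently large and α₀ sufficiently
small) the operators Δ′_a, G′, (Q′G′²Q′*)⁻¹, Δ_a, G are positive definite. … In [4] we have proved that the operator G_□(1) is positive, hence by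
the same reasoning as above we prove positivity of G_□.»*  p. 407, (3.84): *«Δ_a(U′U) = Δ_a(U) − V(A) = (I − V(A)G(U))Δ_a(U)»*.  (3.15)/(3.19)
p. 393: the COMPOSITE averagings `Q_j(U) = Q(Ū^{j−1})…Q(Ū)Q(U)`, `Q′_j(U)`; (3.26) p. 395: *«Δ_a(U) = Δ(U) + D_U R(U) D*_U + Q*(U)aQ(U)»*.

WHY THIS FILE (cell context).  E′ (`B9Thm311SmallFieldCoercivity`, this lineage gen 80) proved the second half of Thm 3.11 at a fixed lattice for
the ONE-STEP averagings (`QtorusW`, `QprimeW`); `B9Eq326OperatorTower` (gen 78) assembled print's `k`-th-step operator with the COMPOSITES `QkW`,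
`QprimeTowerW`, and `B9Eq326OperatorTowerFlat` (gen 83) proved its flat coercivity (`exists_coercive_principalk_one`).  This file is E′ with
the tower letters: the abstract remainder algebra (`B9Eq384RemainderLetters.norm_laplaceAK_sub_le`, `B9Eq368ProjectionRemainder`,
`B9Eq373DerivativeRemainderL2`) is applied VERBATIM on the finest torus `T_{L^{n+1}m}`; what is one-step-specific in E′ — the centre right inverse of
`Q′` and the explicit flat modulus — is replaced by a DISPLAYED right inverse of `Q′_k` (one exists: the composite of the centre lifts; not built
here) and a compactness modulus (§1).

WHAT IS PROVED (sorry-free; no `def`, no `Prop` placeholder; no inequality of the paper asserted as a hypothesis-free fact).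
* §1 **`exists_flat_modulus_tower`** — `∃ μ > 0` with `μ‖λ‖ ≤ ‖Δ^η_1 λ‖` for all `λ ∈ N(Q′_k(1))` (kernel injectivity: `Δ^η_1λ = 0 ⇒ Dλ = 0 ⇒ λ`
  constant ⇒ `Q′_k(1)λ = λ`'s constant (`QprimeTowerW_one_const`) ⇒ `λ = 0`; then `exists_modulus_of_ker_inj`).
* §2 **`norm_principalGFk_sub_flat_le`** — (3.82) for the `k`-level principal operator against the flat one: an EXPLICIT constant in `d`, `η⁻¹`, `εR`,
  `ρ`, `μ`, `δ_Q`, `MQ`, `a` (E′'s, byte-identical) times `‖x‖`, from the transporter closeness `εR`, the flat modulus `μ`, the `ρ`-smallness of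
  `Q′_k(U) − Q′_k(1)` read through DISPLAYED right inverses `S₁` (of `Q′_k(1)`) and `S₂` (of `Q′_k(U)`), the `δ_Q`-closeness of `Q_k(U)` to `Q_k(1)`.
* §3 **`exists_coercive_principalk_of_small_field`** — for every bound `CS ≥ 0` of the right inverses THERE ARE `γ, ε₀ > 0` (finite-lattice numbers)
  such that for EVERY background `U` of the tower's data with `U(b) ∈ U1`, `‖U(b) − 1‖ ≤ ε`, `hRS`, right inverses `S₁, S₂` bounded by `CS`,
  `‖Q′_k(U)λ − Q′_k(1)λ‖_∞ ≤ ρ′‖λ‖`, `‖Q_k(U)x − Q_k(1)x‖ ≤ δ_Q‖x‖` and `ε + ρ′ + δ_Q ≤ ε₀`: `γ‖x‖² ≤ re⟨x, (D*D + DR(U)D* + aQ_k(U)*Q_k(U))x⟩`.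
* §4 **`laplaceAk_pos_of_small_field`** — [B9] THM 3.11 FOR THE `k`-LEVEL OPERATOR `laplaceAk` (WITH the Hessian's curvature part) at every small
  field of a fixed lattice, modulo the same displayed tower letters: `∃ ε₀ > 0 … ∀ x ≠ 0, 0 < re⟨x, Δ_a^{(k)}(U)x⟩` — §3 + the fine-lattice curvature
  bound `B9Ineq369CurvatureSmall.hpos_of_smallCurvature` (plaquettes `4ε`-close to `1`, `B9Thm311SmallFieldClosed.norm_plaqHolU_sub_one_le`);
  **`laplaceAk_pos_of_small_field_unitary`** — `hRS` discharged by `hRS_of_unitary`.  THE DISPLAYED `hpos` OF `B9Eq326OperatorTower.G1k ∕ H1k ∕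
  frakGk` IS THEREBY A THEOREM AT EVERY SMALL FIELD modulo the tower averaging letters.
* §5 (APPEND v1.1, NE9 leaf-02 gen 63 on the OWNER's OFFER W-7∕W-9, `TOWER-SPECIES-PLAN.md` §2 (a)) **`laplaceAk_pos_of_small_field'`**,
  **`laplaceAk_pos_of_small_field_unitary'`** — §4 WITH THE SECTIONS DISCHARGED: the binders `(S₁ S₂ …) hS₁ hS₂ hS₁n hS₂n` and the parameter
  `CS`∕`hCS` are GONE, inhabited by NE9 leaf-02's universal right inverse of the composite `Q′_k`
  (`B9Eq319QprimeTowerCentre.exists_QprimeTowerW_rightInverse`: ONE linear `S`, `Q′_k(U) ∘ S = id` for every `φ`, `U`; `S₁ = S₂ = S`,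
  `CS := (L^d)^{n+1}·√(c₀·#T_m)` — a finite-lattice number carrying the coarse volume).  Displays left in §5: `hRS`∕unitarity, `ρ′`, `δ_Q` only.
MODEL ∕ DECLARED READINGS.  (M1)–(M4) as `B9Eq326OperatorTower`.  (M5) displayed: `hRS`, the tower averaging letters `ρ′`, `δ_Q`, a right inverse
of `Q′_k` with its bound `CS`, `M_φ`, `M_φ′`; (§5: the right inverse and `CS` no longer displayed); proved: everything about `D`, `D*`, `D*D`, `Δ^η_U`, `R(U)`, the flat modulus, the flat constant.
(M6) NOT HERE: print's UNIFORM version (Thm 3.3's decay), the gauge step of p. 416, the curvature part `Δ′(U)` of the Hessian (one storey up it is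
the fine-lattice `B9Ineq369CurvatureSmall` route, as in `B9Thm311SmallFieldClosed`), the tower Lipschitz letters `ρ′_k`, `δ_{Q,k}` themselves.
HONEST SCOPE.  [folklore] finite-dimensional perturbation theory reproducing the MECHANISM of p. 416 / (3.84) for print's `k`-th-step object at a
fixed lattice; NOT summit progress (cell pub-balaban: NE9 NOT PRINTED / NOT PROVED; spine PROVED 0/9).  NEW file; nothing modified.  Net new
unproved facts: 0.
v1.2 (gen 83, DOCFIX, doc-only; every declaration byte-identical in statement and proof): the cite key of the fibre-norming identity «⟨φ⁻¹X, φ⁻¹Y⟩ = τ(X*Y)» in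
the docstrings of `laplaceAk_pos_of_small_field_unitary` and `laplaceAk_pos_of_small_field_unitary'` corrected from «Balaban1985Variational, (18) p.277» to
[Balaban1985Averaging] (17)–(18) pp. 20–21 (summit-lit1 g79 P79-005; t4-ne9-refuter l.32716; the lineage's reading of record).
-/

noncomputable section

open scoped InnerProductSpace ComplexConjugate BigOperators

namespace Literature.MathematicalPhysics.QuantumFieldTheory.Balaban1983to89.B9Thm311SmallFieldCoercivityTower

open B4Sect5Torus (TSite)
open B9SectCLatticeCarrier (Bond)
open B7Prop1Explicit (U1 Wcx boxVec)
open B9Eq311L2Pairing (WL2)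
open B9Eq33CovDerivVector (covDeriv)
open B9Eq319QprimeTorus (fineP)
open B11Eq103H1Complex (SiteL2K BondL2K covDerivL2K covDivL2K covLaplaceSiteK laplaceAK laplaceAK_apply laplaceALatticeK RLatticeK projR
  equiv_covDerivL2K inner_covDivL2K_covDerivL2K)
open B9Eq310HessianOperator (adTransportW adTransportW_apply principalOpK covCurlL2K covCoCurlL2K)
open B9Eq315QTorus (perCfg cornerSite)
open B9Eq315QTower (towerP UlevOf)
open B9Eq315QTowerFlat (perCfg_UlevOf_one_mem_U1 norm_Wcx_UlevOf_one_sub_one_le)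
open B9Eq326OperatorTower (QprimeTowerW QkW RofUk)
open B9Eq326OperatorTowerFlat (QprimeTowerW_one_const exists_coercive_principalk_one)
open B5Eq172HodgePositivity (adTransportW_one coercive_of_sub_le conj_inv_ofReal hRS_one)
open B5Eq172PoincareTorus (const_of_covDeriv_eq_zero)
open B9Eq368ProjectionRemainder (norm_projR_sub_projR_le norm_projR_le exists_modulus_of_ker_inj)
open B9Eq373DerivativeRemainderL2 (norm_adjoint_apply_le norm_covDerivL2K_sub_le norm_covDerivL2K_le norm_covDivL2K_sub_le norm_covDivL2K_le
  norm_covLaplaceSiteK_sub_le norm_covLaplaceSiteK_le norm_principal_sub_le)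
open B9Eq384RemainderLetters (norm_laplaceAK_sub_le adTransportW_one_apply adTransportW_one_inv_apply norm_adTransportW_sub_le)

variable {d : ℕ} (L : ℕ) [NeZero L] (m : Fin d → ℕ) [∀ i, NeZero (m i)] (n : ℕ) (hL : 1 ≤ L)
  {𝔸 : Type*} [NormedRing 𝔸] [NormedAlgebra ℂ 𝔸] [CompleteSpace 𝔸] [NormOneClass 𝔸]
  {W : Type*} [NormedAddCommGroup W] [InnerProductSpace ℂ W] [FiniteDimensional ℂ W] (φ : W ≃ₗ[ℂ] 𝔸) {c₀ c₁ : ℝ} [Fact (0 < c₀)] [Fact (0 < c₁)]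

/-! ## §1 The flat modulus of `Δ^η_1` on `N(Q′_k(1))` (compactness witness) -/

section FlatModulus

variable {η : ℝ} (hη : η ≠ 0)

include hη in
omit [NormOneClass 𝔸] in
/-- **THE FLAT INJECTIVITY MODULUS ON `N(Q′_k(1))`, `k = n+1` LEVELS**: `∃ μ > 0` with `μ‖λ‖ ≤ ‖Δ^η_1 λ‖` whenever `Q′_k(1)λ = 0` — `Δ^η_1 λ = 0`
forces `D λ = 0` (`⟨λ, D*Dλ⟩ = ‖Dλ‖²`), hence `λ` constant (p. 22), hence `Q′_k(1)λ` is that constant (`QprimeTowerW_one_const`), hence `λ = 0`;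
the modulus is the compactness witness of `B9Eq368ProjectionRemainder.exists_modulus_of_ker_inj` (the explicit block-Poincaré constant of NE9
leaf-04's `B9Eq323FlatBlockPoincare` is the one-step case). [cite: Balaban1985BackgroundPropagators, (3.21)–(3.23) p.394; Balaban1984PropagatorsI, p.22] -/
theorem exists_flat_modulus_tower :
    ∃ μ : ℝ, 0 < μ ∧ ∀ l : SiteL2K ℂ d (towerP L m (n + 1)) c₀ W,
      QprimeTowerW L m n φ (fun _ : Bond d (towerP L m (n + 1)) => (1 : 𝔸ˣ)) l = 0 →
        μ * ‖l‖ ≤ ‖covLaplaceSiteK ((η : ℂ))⁻¹ (adTransportW φ (fun _ : Bond d (towerP L m (n + 1)) => (1 : 𝔸ˣ)))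
          (adTransportW φ fun _ : Bond d (towerP L m (n + 1)) => (1 : 𝔸ˣ)⁻¹) l‖ := by
  have hc : ((η : ℂ))⁻¹ ≠ 0 := inv_ne_zero (Complex.ofReal_ne_zero.2 hη)
  refine exists_modulus_of_ker_inj _ _ fun l hQ hΔ => ?_
  -- `Δ^η_1 l = 0 ⇒ D l = 0`
  have hD : covDerivL2K ℂ c₀ ((η : ℂ))⁻¹ (adTransportW φ (fun _ : Bond d (towerP L m (n + 1)) => (1 : 𝔸ˣ))) l = 0 := by
    have h := inner_covDivL2K_covDerivL2K (c₀ := c₀) ((η : ℂ))⁻¹ (conj_inv_ofReal η) _ _ (hRS_one φ) l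
    rw [covLaplaceSiteK, LinearMap.comp_apply] at hΔ
    rw [hΔ, inner_zero_right] at h
    have h4 := pow_eq_zero_iff two_ne_zero |>.1 h.symm
    have h5 : ‖covDerivL2K ℂ c₀ ((η : ℂ))⁻¹ (adTransportW φ (fun _ : Bond d (towerP L m (n + 1)) => (1 : 𝔸ˣ))) l‖ = 0 := by
      simpa using h4
    exact norm_eq_zero.1 h5
  -- `D l = 0 ⇒ l` constant
  have hD' : covDeriv ((η : ℂ))⁻¹ (adTransportW φ (fun _ : Bond d (towerP L m (n + 1)) => (1 : 𝔸ˣ))) (WL2.equiv ℂ _ W l) = 0 := by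
    have h := congrArg (WL2.equiv ℂ (fun _ : Bond d (towerP L m (n + 1)) => c₀) W) hD
    rw [equiv_covDerivL2K, WL2.equiv_zero] at h
    exact h
  have hconst : WL2.equiv ℂ _ W l = fun _ => WL2.equiv ℂ _ W l 0 :=
    funext fun y => const_of_covDeriv_eq_zero hc (adTransportW_one φ) hD' y
  have hl : l = (WL2.equiv ℂ (fun _ : TSite d (towerP L m (n + 1)) => c₀) W).symm fun _ => WL2.equiv ℂ _ W l 0 := by
    rw [← hconst, Equiv.symm_apply_apply]
  -- `Q′_k(1) l` is that constant, so it vanishes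
  have hv : WL2.equiv ℂ (fun _ : TSite d (towerP L m (n + 1)) => c₀) W l 0 = 0 := by
    have h := congr_fun (by rw [hl, QprimeTowerW_one_const L m n φ] at hQ; exact hQ :
      (fun _ : TSite d m => WL2.equiv ℂ (fun _ : TSite d (towerP L m (n + 1)) => c₀) W l 0) = 0) (fun i => ⟨0, Nat.pos_of_ne_zero (NeZero.ne (m i))⟩)
    exact h
  rw [hl, hv]
  rfl

end FlatModulus

/-! ## §2 (3.82) for the `k`-level principal operator against the flat one, ASSEMBLED -/

section Assembly

variable (η : ℝ) (a : ℝ) (U : Bond d (towerP L m (n + 1)) → 𝔸ˣ) (α : ℕ → ℝ) (hα1 : ∀ j, α j ≤ 1 / 64)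
  (hU1 : ∀ (j : ℕ) (x : B7Prop1Explicit.Site d) (κ : Fin d), perCfg (towerP L m (j + 1)) (UlevOf L m (n + 1) U j) x κ ∈ U1 𝔸)
  (hreg : ∀ (j : ℕ) (y : TSite d (towerP L m j)) (κ : Fin d) (r : Fin d → Fin L),
    ‖((Wcx L (perCfg (towerP L m (j + 1)) (UlevOf L m (n + 1) U j)) (cornerSite L y) κ (boxVec L r) : 𝔸ˣ) : 𝔸) - 1‖ ≤ α j)

/-- **(3.82)∕(3.84) FOR THE `k`-LEVEL PRINCIPAL GAUGE-FIXED OPERATOR `D*D + DR(U)D* + aQ_k(U)*Q_k(U)` AGAINST THE FLAT ONE** — E′ §5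
`norm_principalGF_sub_flat_le` with the tower letters: the `εR`-closeness of the transporters and their mutual adjointness ⇒ the `D*D`-part and the
`D`, `D*`, `Δ^η_U` letters (`B9Eq373DerivativeRemainderL2`, print's `V₁`/`V₃`); the flat modulus `μ` (§1) and the `ρ`-smallness of `Q′_k(U) − Q′_k(1)`
READ THROUGH right inverses `S₁` of `Q′_k(1)` and `S₂` of `Q′_k(U)` (DISPLAYED) ⇒ the `R`-part (`B9Eq368ProjectionRemainder`, print's `P₁`); the
`δ_Q`-closeness of `Q_k(U)` to `Q_k(1)` with a bound `MQ` of `Q_k(1)` ⇒ the `Q`-part (print's `P₂`/`F₂`; DISPLAYED).  The constant is E′'s.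
[cite: Balaban1985BackgroundPropagators, (3.82)–(3.84) p.407, (3.70)–(3.77) pp.404–406, Thm 3.11 p.416] -/
theorem norm_principalGFk_sub_flat_le {εR ρ δQ MQ μ : ℝ} (hεR : 0 ≤ εR) (hρ0 : 0 ≤ ρ) (hδQ0 : 0 ≤ δQ) (hMQ : 0 ≤ MQ) (hμ : 0 < μ)
    (hR : ∀ (b : Bond d (towerP L m (n + 1))) (w : W), ‖adTransportW φ U b w - w‖ ≤ εR * ‖w‖)
    (hRS : ∀ (b : Bond d (towerP L m (n + 1))) (v u : W), ⟪adTransportW φ U b v, u⟫_ℂ = ⟪v, adTransportW φ (fun b => (U b)⁻¹) b u⟫_ℂ)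
    (hmod : ∀ l : SiteL2K ℂ d (towerP L m (n + 1)) c₀ W, QprimeTowerW L m n φ (fun _ : Bond d (towerP L m (n + 1)) => (1 : 𝔸ˣ)) l = 0 →
      μ * ‖l‖ ≤ ‖covLaplaceSiteK ((η : ℂ))⁻¹ (adTransportW φ (fun _ : Bond d (towerP L m (n + 1)) => (1 : 𝔸ˣ)))
        (adTransportW φ fun _ : Bond d (towerP L m (n + 1)) => (1 : 𝔸ˣ)⁻¹) l‖)
    (S₁ S₂ : (TSite d m → W) →ₗ[ℂ] SiteL2K ℂ d (towerP L m (n + 1)) c₀ W)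
    (hS₁ : ∀ f, QprimeTowerW L m n φ (fun _ : Bond d (towerP L m (n + 1)) => (1 : 𝔸ˣ)) (S₁ f) = f)
    (hS₂ : ∀ f, QprimeTowerW L m n φ U (S₂ f) = f)
    (hρ₁ : ∀ l : SiteL2K ℂ d (towerP L m (n + 1)) c₀ W,
      ‖S₁ (QprimeTowerW L m n φ (fun _ : Bond d (towerP L m (n + 1)) => (1 : 𝔸ˣ)) l - QprimeTowerW L m n φ U l)‖ ≤ ρ * ‖l‖)
    (hρ₂ : ∀ l : SiteL2K ℂ d (towerP L m (n + 1)) c₀ W,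
      ‖S₂ (QprimeTowerW L m n φ U l - QprimeTowerW L m n φ (fun _ : Bond d (towerP L m (n + 1)) => (1 : 𝔸ˣ)) l)‖ ≤ ρ * ‖l‖)
    (hQ : ∀ x : BondL2K ℂ d (towerP L m (n + 1)) c₀ W, ‖QkW L m n φ U hL α hα1 hU1 hreg (c₁ := c₁) x -
      QkW L m n φ (fun _ : Bond d (towerP L m (n + 1)) => (1 : 𝔸ˣ)) hL (fun _ => 0) (fun _ => by norm_num)
        (perCfg_UlevOf_one_mem_U1 L m (n + 1)) (norm_Wcx_UlevOf_one_sub_one_le L m (n + 1) (fun _ => 0) (fun _ => le_rfl)) (c₁ := c₁) x‖ ≤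
      δQ * ‖x‖)
    (hQ₁ : ∀ x : BondL2K ℂ d (towerP L m (n + 1)) c₀ W,
      ‖QkW L m n φ (fun _ : Bond d (towerP L m (n + 1)) => (1 : 𝔸ˣ)) hL (fun _ => 0) (fun _ => by norm_num)
        (perCfg_UlevOf_one_mem_U1 L m (n + 1)) (norm_Wcx_UlevOf_one_sub_one_le L m (n + 1) (fun _ => 0) (fun _ => le_rfl)) (c₁ := c₁) x‖ ≤
      MQ * ‖x‖)
    (hν : 0 < μ * (1 - ρ) - (2 * (2 + εR) * ‖((η : ℂ))⁻¹‖ ^ 2 * d * εR + 4 * (1 + εR) ^ 2 * ‖((η : ℂ))⁻¹‖ ^ 2 * d * ρ))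
    (x : BondL2K ℂ d (towerP L m (n + 1)) c₀ W) :
    ‖laplaceALatticeK ((η : ℂ))⁻¹ (adTransportW φ U) (adTransportW φ fun b => (U b)⁻¹) (principalOpK φ η U) (RofUk L m n φ η U)
        (QkW L m n φ U hL α hα1 hU1 hreg (c₁ := c₁)) a x -
      laplaceALatticeK ((η : ℂ))⁻¹ (adTransportW φ (fun _ : Bond d (towerP L m (n + 1)) => (1 : 𝔸ˣ)))
        (adTransportW φ fun _ : Bond d (towerP L m (n + 1)) => (1 : 𝔸ˣ)⁻¹) (principalOpK φ η fun _ => 1)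
        (RofUk L m n φ η fun _ : Bond d (towerP L m (n + 1)) => (1 : 𝔸ˣ))
        (QkW L m n φ (fun _ : Bond d (towerP L m (n + 1)) => (1 : 𝔸ˣ)) hL (fun _ => 0) (fun _ => by norm_num)
          (perCfg_UlevOf_one_mem_U1 L m (n + 1)) (norm_Wcx_UlevOf_one_sub_one_le L m (n + 1) (fun _ => 0) (fun _ => le_rfl)) (c₁ := c₁)) a x‖ ≤
      (16 * d * (2 + εR) * ‖((η : ℂ))⁻¹‖ ^ 2 * εR
        + 2 * (2 * (1 + εR) * ‖((η : ℂ))⁻¹‖ * Real.sqrt d) * (‖((η : ℂ))⁻¹‖ * εR * Real.sqrt d)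
        + (2 * (1 + εR) * ‖((η : ℂ))⁻¹‖ * Real.sqrt d) ^ 2 *
          (2 * (2 * (2 + εR) * ‖((η : ℂ))⁻¹‖ ^ 2 * d * εR + 4 * (1 + εR) ^ 2 * ‖((η : ℂ))⁻¹‖ ^ 2 * d * ρ) /
            (μ * (1 - ρ) - (2 * (2 + εR) * ‖((η : ℂ))⁻¹‖ ^ 2 * d * εR + 4 * (1 + εR) ^ 2 * ‖((η : ℂ))⁻¹‖ ^ 2 * d * ρ)))
        + |a| * δQ * (2 * MQ + δQ)) * ‖x‖ := by
  have hc : conj ((η : ℂ))⁻¹ = ((η : ℂ))⁻¹ := by rw [map_inv₀, Complex.conj_ofReal]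
  -- the flat letters act as identities
  have hR₁ : ∀ (b : Bond d (towerP L m (n + 1))) (w : W), adTransportW φ (fun _ : Bond d (towerP L m (n + 1)) => (1 : 𝔸ˣ)) b w = w :=
    adTransportW_one_apply L (towerP L m n) φ
  have hS₁' : ∀ (b : Bond d (towerP L m (n + 1))) (w : W), adTransportW φ (fun _ : Bond d (towerP L m (n + 1)) => (1 : 𝔸ˣ)⁻¹) b w = w :=
    adTransportW_one_inv_apply L (towerP L m n) φ
  have hR₁ε : ∀ (b : Bond d (towerP L m (n + 1))) (w : W),
      ‖adTransportW φ (fun _ : Bond d (towerP L m (n + 1)) => (1 : 𝔸ˣ)) b w - w‖ ≤ εR * ‖w‖ :=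
    fun b w => by rw [hR₁, sub_self, norm_zero]; positivity
  have hRS₁ := B9Eq384RemainderLetters.hRS_one L (towerP L m n) φ (𝔸 := 𝔸)
  -- the `R`-part
  have hM : 0 ≤ 4 * (1 + εR) ^ 2 * ‖((η : ℂ))⁻¹‖ ^ 2 * d := by positivity
  have hε : 0 ≤ 2 * (2 + εR) * ‖((η : ℂ))⁻¹‖ ^ 2 * d * εR := by positivity
  have hRdiff : ∀ z : SiteL2K ℂ d (towerP L m (n + 1)) c₀ W,
      ‖RofUk L m n φ η U z - RofUk L m n φ η (fun _ => 1) z‖ ≤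
      2 * (2 * (2 + εR) * ‖((η : ℂ))⁻¹‖ ^ 2 * d * εR + 4 * (1 + εR) ^ 2 * ‖((η : ℂ))⁻¹‖ ^ 2 * d * ρ) /
        (μ * (1 - ρ) - (2 * (2 + εR) * ‖((η : ℂ))⁻¹‖ ^ 2 * d * εR + 4 * (1 + εR) ^ 2 * ‖((η : ℂ))⁻¹‖ ^ 2 * d * ρ)) * ‖z‖ := fun z => by
    rw [norm_sub_rev]
    unfold RofUk RLatticeK
    exact norm_projR_sub_projR_le _ _ _ _ S₁ S₂ hS₁ hS₂ hμ hM hε hρ0 hmod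
      (norm_covLaplaceSiteK_le _ hc hεR hR₁ε hRS₁) (norm_covLaplaceSiteK_le _ hc hεR hR hRS)
      (norm_covLaplaceSiteK_sub_le _ hc hεR hR hR₁ hRS hS₁') hρ₂ hρ₁ hν z
  -- the `D*D`-part in the letters `principalOpK`
  have hP : ∀ y : BondL2K ℂ d (towerP L m (n + 1)) c₀ W,
      ‖principalOpK φ η U y - principalOpK φ η (fun _ : Bond d (towerP L m (n + 1)) => (1 : 𝔸ˣ)) y‖ ≤
      16 * d * (2 + εR) * ‖((η : ℂ))⁻¹‖ ^ 2 * εR * ‖y‖ := fun y => by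
    rw [B9Eq310HessianOperator.principalOpK_eq_comp, B9Eq310HessianOperator.principalOpK_eq_comp, LinearMap.comp_apply,
      LinearMap.comp_apply]
    exact norm_principal_sub_le _ hc hεR hR hR₁ hRS hS₁' y
  have hδR0 : 0 ≤ 2 * (2 * (2 + εR) * ‖((η : ℂ))⁻¹‖ ^ 2 * d * εR + 4 * (1 + εR) ^ 2 * ‖((η : ℂ))⁻¹‖ ^ 2 * d * ρ) /
      (μ * (1 - ρ) - (2 * (2 + εR) * ‖((η : ℂ))⁻¹‖ ^ 2 * d * εR + 4 * (1 + εR) ^ 2 * ‖((η : ℂ))⁻¹‖ ^ 2 * d * ρ)) :=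
    div_nonneg (by positivity) hν.le
  have hRn₁ : ∀ z : SiteL2K ℂ d (towerP L m (n + 1)) c₀ W,
      ‖RofUk L m n φ η (fun _ : Bond d (towerP L m (n + 1)) => (1 : 𝔸ˣ)) z‖ ≤ ‖z‖ := fun z => by
    unfold RofUk RLatticeK; exact norm_projR_le _ _ z
  have hRn₂ : ∀ z : SiteL2K ℂ d (towerP L m (n + 1)) c₀ W, ‖RofUk L m n φ η U z‖ ≤ ‖z‖ := fun z => by
    unfold RofUk RLatticeK; exact norm_projR_le _ _ z
  -- the `D`, `D*` letters
  have hD : ∀ f : SiteL2K ℂ d (towerP L m (n + 1)) c₀ W,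
      ‖covDerivL2K ℂ c₀ ((η : ℂ))⁻¹ (adTransportW φ U) f -
        covDerivL2K ℂ c₀ ((η : ℂ))⁻¹ (adTransportW φ (fun _ : Bond d (towerP L m (n + 1)) => (1 : 𝔸ˣ))) f‖ ≤
        ‖((η : ℂ))⁻¹‖ * εR * Real.sqrt d * ‖f‖ := norm_covDerivL2K_sub_le _ hεR hR hR₁
  have hDs : ∀ y : BondL2K ℂ d (towerP L m (n + 1)) c₀ W,
      ‖covDivL2K ℂ c₀ ((η : ℂ))⁻¹ (adTransportW φ fun b => (U b)⁻¹) y -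
        covDivL2K ℂ c₀ ((η : ℂ))⁻¹ (adTransportW φ fun _ : Bond d (towerP L m (n + 1)) => (1 : 𝔸ˣ)⁻¹) y‖ ≤
        ‖((η : ℂ))⁻¹‖ * εR * Real.sqrt d * ‖y‖ := norm_covDivL2K_sub_le _ hc hεR hR hR₁ hRS hS₁'
  have hD₁ : ∀ f : SiteL2K ℂ d (towerP L m (n + 1)) c₀ W,
      ‖covDerivL2K ℂ c₀ ((η : ℂ))⁻¹ (adTransportW φ (fun _ : Bond d (towerP L m (n + 1)) => (1 : 𝔸ˣ))) f‖ ≤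
        2 * (1 + εR) * ‖((η : ℂ))⁻¹‖ * Real.sqrt d * ‖f‖ :=
    norm_covDerivL2K_le _ hεR hR₁ε
  have hDs₂ : ∀ y : BondL2K ℂ d (towerP L m (n + 1)) c₀ W,
      ‖covDivL2K ℂ c₀ ((η : ℂ))⁻¹ (adTransportW φ fun b => (U b)⁻¹) y‖ ≤ 2 * (1 + εR) * ‖((η : ℂ))⁻¹‖ * Real.sqrt d * ‖y‖ :=
    norm_covDivL2K_le _ hc hεR hR hRS
  have hMD : (0 : ℝ) ≤ 2 * (1 + εR) * ‖((η : ℂ))⁻¹‖ * Real.sqrt d := by positivity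
  have hδD : (0 : ℝ) ≤ ‖((η : ℂ))⁻¹‖ * εR * Real.sqrt d := by positivity
  -- the assembly (the real constant is closed by `ring`, not by unification)
  have key := @norm_laplaceAK_sub_le ℂ _ (BondL2K ℂ d (towerP L m (n + 1)) c₀ W) (SiteL2K ℂ d (towerP L m (n + 1)) c₀ W) (BondL2K ℂ d m c₁ W)
    _ _ _ _ _ _ _ _ (principalOpK φ η fun _ : Bond d (towerP L m (n + 1)) => (1 : 𝔸ˣ)) (principalOpK φ η U)
    (covDerivL2K ℂ c₀ ((η : ℂ))⁻¹ (adTransportW φ (fun _ : Bond d (towerP L m (n + 1)) => (1 : 𝔸ˣ))))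
    (covDerivL2K ℂ c₀ ((η : ℂ))⁻¹ (adTransportW φ U))
    (RofUk L m n φ η fun _ : Bond d (towerP L m (n + 1)) => (1 : 𝔸ˣ)) (RofUk L m n φ η U)
    (covDivL2K ℂ c₀ ((η : ℂ))⁻¹ (adTransportW φ fun _ : Bond d (towerP L m (n + 1)) => (1 : 𝔸ˣ)⁻¹))
    (covDivL2K ℂ c₀ ((η : ℂ))⁻¹ (adTransportW φ fun b => (U b)⁻¹))
    (QkW L m n φ (fun _ : Bond d (towerP L m (n + 1)) => (1 : 𝔸ˣ)) hL (fun _ => 0) (fun _ => by norm_num)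
      (perCfg_UlevOf_one_mem_U1 L m (n + 1)) (norm_Wcx_UlevOf_one_sub_one_le L m (n + 1) (fun _ => 0) (fun _ => le_rfl)) (c₁ := c₁))
    (QkW L m n φ U hL α hα1 hU1 hreg (c₁ := c₁)) a _ _ _ _ _ _ hMD hMQ hδD hδR0 hδQ0 hP hD hDs hD₁ hDs₂ hRn₁ hRn₂ hRdiff hQ hQ₁ x
  refine key.trans (le_of_eq ?_)
  ring

end Assembly

/-! ## §3 [B9] Thm 3.11's second half at `k` levels and a fixed lattice: `∃ γ ε₀ > 0` -/

section SmallField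

/-- arithmetic helper: `t ≤ μ/(2B+1)` gives `B·t ≤ μ/2`. [folklore] -/
private theorem mul_le_half_of_le_div {B μ t : ℝ} (hB : 0 ≤ B) (hμ : 0 ≤ μ) (ht : t ≤ μ / (2 * B + 1)) : B * t ≤ μ / 2 := by
  have h1 : B * t ≤ B * (μ / (2 * B + 1)) := mul_le_mul_of_nonneg_left ht hB
  have h2 : B * (μ / (2 * B + 1)) ≤ μ / 2 := by
    rw [mul_div_assoc', div_le_div_iff₀ (by positivity) (by norm_num)]
    nlinarith
  exact h1.trans h2

variable (α : ℕ → ℝ) (hα1 : ∀ j, α j ≤ 1 / 64)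

set_option maxHeartbeats 400000 in
/-- **[B9] THM 3.11, SECOND HALF, AT `k = n+1` LEVELS AND A FIXED LATTICE: THE `k`-LEVEL PRINCIPAL GAUGE-FIXED OPERATOR IS UNIFORMLY COERCIVE AT
EVERY SMALL FIELD** — E′ `exists_coercive_principal_of_small_field` one storey up.  For every bound `CS ≥ 0` THERE ARE `γ, ε₀ > 0` (finite-lattice
numbers: the flat constant of `B9Eq326OperatorTowerFlat.exists_coercive_principalk_one`, the flat modulus of §1, the operator norm of `Q_k(1)`, `d`,
`η`, `L`, `c₀`, `a`, `M_φ`, `M_φ′`, `CS`) such that for EVERY background `U` of the tower's displayed data with unit-bounded `ε`-small bond variables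
(`‖U(b) − 1‖ ≤ ε`), mutually adjoint transporters (`hRS`), right inverses `S₁` of `Q′_k(1)` and `S₂` of `Q′_k(U)` bounded by `CS` from the sup norm
(DISPLAYED; the composite of the centre lifts is one such, `U`-independently), and TOWER averaging operators Lipschitz-close to the flat ones —
`‖Q′_k(U)λ − Q′_k(1)λ‖_∞ ≤ ρ′‖λ‖`, `‖Q_k(U)x − Q_k(1)x‖ ≤ δ_Q‖x‖` (DISPLAYED) — with `ε + ρ′ + δ_Q ≤ ε₀`, the coercivity
`γ‖x‖² ≤ re⟨x, (D*D + DR(U)D* + aQ_k(U)*Q_k(U))x⟩` HOLDS.  No uniformity in the lattice or in `k`.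
[cite: Balaban1985BackgroundPropagators, Thm 3.11 p.416, (3.82)–(3.86) p.407, (3.15) p.393; Balaban1984PropagatorsI, (1.72) p.30] -/
theorem exists_coercive_principalk_of_small_field {η : ℝ} (hη : η ≠ 0) {a : ℝ} (ha : 0 < a) {Mφ Mφ' : ℝ} (hMφ : 0 ≤ Mφ) (hMφ' : 0 ≤ Mφ')
    (hφ : ∀ w, ‖φ w‖ ≤ Mφ * ‖w‖) (hφ' : ∀ X, ‖φ.symm X‖ ≤ Mφ' * ‖X‖) {CS : ℝ} (hCS : 0 ≤ CS) :
    ∃ γ ε₀ : ℝ, 0 < γ ∧ 0 < ε₀ ∧ ∀ (U : Bond d (towerP L m (n + 1)) → 𝔸ˣ)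
      (hU1 : ∀ (j : ℕ) (x : B7Prop1Explicit.Site d) (κ : Fin d), perCfg (towerP L m (j + 1)) (UlevOf L m (n + 1) U j) x κ ∈ U1 𝔸)
      (hreg : ∀ (j : ℕ) (y : TSite d (towerP L m j)) (κ : Fin d) (r : Fin d → Fin L),
        ‖((Wcx L (perCfg (towerP L m (j + 1)) (UlevOf L m (n + 1) U j)) (cornerSite L y) κ (boxVec L r) : 𝔸ˣ) : 𝔸) - 1‖ ≤ α j)
      (S₁ S₂ : (TSite d m → W) →ₗ[ℂ] SiteL2K ℂ d (towerP L m (n + 1)) c₀ W)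
      {ε ρ' δQ : ℝ}, 0 ≤ ε → 0 ≤ ρ' → 0 ≤ δQ → ε + ρ' + δQ ≤ ε₀ →
      (∀ b, U b ∈ U1 𝔸) → (∀ b, ‖(U b : 𝔸) - 1‖ ≤ ε) →
      (∀ (b : Bond d (towerP L m (n + 1))) (v u : W), ⟪adTransportW φ U b v, u⟫_ℂ = ⟪v, adTransportW φ (fun b => (U b)⁻¹) b u⟫_ℂ) →
      (∀ f, QprimeTowerW L m n φ (fun _ : Bond d (towerP L m (n + 1)) => (1 : 𝔸ˣ)) (S₁ f) = f) →
      (∀ f, QprimeTowerW L m n φ U (S₂ f) = f) → (∀ f, ‖S₁ f‖ ≤ CS * ‖f‖) → (∀ f, ‖S₂ f‖ ≤ CS * ‖f‖) →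
      (∀ l : SiteL2K ℂ d (towerP L m (n + 1)) c₀ W,
        ‖QprimeTowerW L m n φ U l - QprimeTowerW L m n φ (fun _ : Bond d (towerP L m (n + 1)) => (1 : 𝔸ˣ)) l‖ ≤ ρ' * ‖l‖) →
      (∀ x : BondL2K ℂ d (towerP L m (n + 1)) c₀ W, ‖QkW L m n φ U hL α hα1 hU1 hreg (c₁ := c₁) x -
        QkW L m n φ (fun _ : Bond d (towerP L m (n + 1)) => (1 : 𝔸ˣ)) hL (fun _ => 0) (fun _ => by norm_num)
          (perCfg_UlevOf_one_mem_U1 L m (n + 1)) (norm_Wcx_UlevOf_one_sub_one_le L m (n + 1) (fun _ => 0) (fun _ => le_rfl)) (c₁ := c₁) x‖ ≤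
        δQ * ‖x‖) →
      ∀ x : BondL2K ℂ d (towerP L m (n + 1)) c₀ W, γ * ‖x‖ ^ 2 ≤
        RCLike.re ⟪x, laplaceALatticeK ((η : ℂ))⁻¹ (adTransportW φ U) (adTransportW φ fun b => (U b)⁻¹) (principalOpK φ η U) (RofUk L m n φ η U)
          (QkW L m n φ U hL α hα1 hU1 hreg (c₁ := c₁)) a x⟫_ℂ := by
  have hc₀ : 0 < c₀ := Fact.out
  -- the flat constants: `γ₀` (gen 83's tower Hodge package), `μ` (§1), `MQ = ‖Q_k(1)‖`
  obtain ⟨γ₀, hγ₀, hflat⟩ := exists_coercive_principalk_one L m n hL φ (c₀ := c₀) (c₁ := c₁) hη (fun _ => 0) (fun _ => by norm_num)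
    (perCfg_UlevOf_one_mem_U1 L m (n + 1)) (norm_Wcx_UlevOf_one_sub_one_le L m (n + 1) (fun _ => 0) (fun _ => le_rfl)) ha
  obtain ⟨μ, hμ, hmod⟩ := exists_flat_modulus_tower L m n φ (c₀ := c₀) hη
  obtain ⟨MQ, hMQdef⟩ : ∃ MQ : ℝ, MQ = ‖LinearMap.toContinuousLinearMap
    (QkW L m n φ (fun _ : Bond d (towerP L m (n + 1)) => (1 : 𝔸ˣ)) hL (fun _ => 0) (fun _ => by norm_num)
      (perCfg_UlevOf_one_mem_U1 L m (n + 1)) (norm_Wcx_UlevOf_one_sub_one_le L m (n + 1) (fun _ => 0) (fun _ => le_rfl)) (c₀ := c₀) (c₁ := c₁))‖ :=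
    ⟨_, rfl⟩
  have hMQ : 0 ≤ MQ := by rw [hMQdef]; positivity
  have hQ₁ : ∀ x : BondL2K ℂ d (towerP L m (n + 1)) c₀ W,
      ‖QkW L m n φ (fun _ : Bond d (towerP L m (n + 1)) => (1 : 𝔸ˣ)) hL (fun _ => 0) (fun _ => by norm_num)
        (perCfg_UlevOf_one_mem_U1 L m (n + 1)) (norm_Wcx_UlevOf_one_sub_one_le L m (n + 1) (fun _ => 0) (fun _ => le_rfl)) (c₀ := c₀) (c₁ := c₁) x‖ ≤
      MQ * ‖x‖ := fun x => by
    rw [hMQdef]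
    exact (LinearMap.toContinuousLinearMap
      (QkW L m n φ (fun _ : Bond d (towerP L m (n + 1)) => (1 : 𝔸ˣ)) hL (fun _ => 0) (fun _ => by norm_num)
        (perCfg_UlevOf_one_mem_U1 L m (n + 1)) (norm_Wcx_UlevOf_one_sub_one_le L m (n + 1) (fun _ => 0) (fun _ => le_rfl))
        (c₀ := c₀) (c₁ := c₁))).le_opNorm x
  -- the lattice constants
  have hnc : 0 ≤ ‖((η : ℂ))⁻¹‖ := norm_nonneg _
  obtain ⟨KR, hKRdef⟩ : ∃ KR : ℝ, KR = 2 * Mφ * Mφ' := ⟨_, rfl⟩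
  have hKR : 0 ≤ KR := by rw [hKRdef]; positivity
  obtain ⟨B, hBdef⟩ : ∃ B : ℝ, B = μ * CS + 6 * ‖((η : ℂ))⁻¹‖ ^ 2 * d * KR + 16 * ‖((η : ℂ))⁻¹‖ ^ 2 * d * CS := ⟨_, rfl⟩
  have hB : 0 ≤ B := by rw [hBdef]; positivity
  obtain ⟨K, hKdef⟩ : ∃ K : ℝ, K = 48 * d * ‖((η : ℂ))⁻¹‖ ^ 2 * KR + 8 * ‖((η : ℂ))⁻¹‖ ^ 2 * d * KR + 64 * ‖((η : ℂ))⁻¹‖ ^ 2 * d * (6 * ‖((η : ℂ))⁻¹‖ ^ 2 * d * KR + 16 * ‖((η : ℂ))⁻¹‖ ^ 2 * d * CS) / μ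
    + |a| * (2 * MQ + 1) := ⟨_, rfl⟩
  have hK : 0 ≤ K := by rw [hKdef]; positivity
  refine ⟨γ₀ / 2, min (1 / (KR + 1)) (min (μ / (2 * B + 1)) (γ₀ / (2 * K + 1))), by positivity, by positivity, ?_⟩
  intro U hU1 hreg S₁ S₂ ε ρ' δQ hε hρ' hδQ ht hUb hUε hRS hS₁ hS₂ hS₁n hS₂n hQ' hQ x
  -- `t = ε + ρ′ + δ_Q` and its three consequences
  have ht1 : ε + ρ' + δQ ≤ 1 / (KR + 1) := ht.trans (min_le_left _ _)
  have ht2 : ε + ρ' + δQ ≤ μ / (2 * B + 1) := ht.trans ((min_le_right _ _).trans (min_le_left _ _))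
  have ht3 : ε + ρ' + δQ ≤ γ₀ / (2 * K + 1) := ht.trans ((min_le_right _ _).trans (min_le_right _ _))
  have hεt : ε ≤ ε + ρ' + δQ := by linarith
  have hρt : ρ' ≤ ε + ρ' + δQ := by linarith
  have hδQt : δQ ≤ ε + ρ' + δQ := by linarith
  have ht01 : ε + ρ' + δQ ≤ 1 := ht1.trans (by rw [div_le_one (by positivity)]; linarith)
  have hδQ1 : δQ ≤ 1 := hδQt.trans ht01
  -- the letters of §2
  obtain ⟨εR, hεRdef⟩ : ∃ εR : ℝ, εR = KR * ε := ⟨_, rfl⟩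
  have hεR : 0 ≤ εR := by rw [hεRdef]; positivity
  have hεRt : εR ≤ KR * (ε + ρ' + δQ) := by rw [hεRdef]; exact mul_le_mul_of_nonneg_left hεt hKR
  have hεR1 : εR ≤ 1 := by
    refine hεRt.trans ((mul_le_mul_of_nonneg_left ht1 hKR).trans ?_)
    rw [mul_one_div, div_le_one (by positivity)]; linarith
  have hR : ∀ (b : Bond d (towerP L m (n + 1))) (w : W), ‖adTransportW φ U b w - w‖ ≤ εR * ‖w‖ := fun b w => by
    have h := norm_adTransportW_sub_le φ hφ hφ' hMφ' U b (hUb b) (hUε b) w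
    rw [hεRdef, hKRdef]; linarith
  obtain ⟨ρ, hρdef⟩ : ∃ ρ : ℝ, ρ = CS * ρ' := ⟨_, rfl⟩
  have hρ0 : 0 ≤ ρ := by rw [hρdef]; positivity
  have hρ₂ : ∀ l : SiteL2K ℂ d (towerP L m (n + 1)) c₀ W,
      ‖S₂ (QprimeTowerW L m n φ U l - QprimeTowerW L m n φ (fun _ : Bond d (towerP L m (n + 1)) => (1 : 𝔸ˣ)) l)‖ ≤ ρ * ‖l‖ := fun l =>
    (hS₂n _).trans (by
      calc CS * ‖QprimeTowerW L m n φ U l - QprimeTowerW L m n φ (fun _ : Bond d (towerP L m (n + 1)) => (1 : 𝔸ˣ)) l‖ ≤ CS * (ρ' * ‖l‖) :=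
            mul_le_mul_of_nonneg_left (hQ' l) hCS
        _ = ρ * ‖l‖ := by rw [hρdef]; ring)
  have hρ₁ : ∀ l : SiteL2K ℂ d (towerP L m (n + 1)) c₀ W,
      ‖S₁ (QprimeTowerW L m n φ (fun _ : Bond d (towerP L m (n + 1)) => (1 : 𝔸ˣ)) l - QprimeTowerW L m n φ U l)‖ ≤ ρ * ‖l‖ := fun l =>
    (hS₁n _).trans (by
      rw [norm_sub_rev]
      calc CS * ‖QprimeTowerW L m n φ U l - QprimeTowerW L m n φ (fun _ : Bond d (towerP L m (n + 1)) => (1 : 𝔸ˣ)) l‖ ≤ CS * (ρ' * ‖l‖) :=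
            mul_le_mul_of_nonneg_left (hQ' l) hCS
        _ = ρ * ‖l‖ := by rw [hρdef]; ring)
  have hρt : ρ ≤ CS * (ε + ρ' + δQ) := by rw [hρdef]; exact mul_le_mul_of_nonneg_left hρt hCS
  -- the smallness bookkeeping: `εΔ + Mρ + μρ ≤ B·t ≤ μ/2`
  have hd0 : (0 : ℝ) ≤ d := Nat.cast_nonneg d
  have hsd : Real.sqrt d * Real.sqrt d = d := Real.mul_self_sqrt hd0
  have hεΔ : 2 * (2 + εR) * ‖((η : ℂ))⁻¹‖ ^ 2 * d * εR ≤ 6 * ‖((η : ℂ))⁻¹‖ ^ 2 * d * KR * (ε + ρ' + δQ) := by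
    have h1 : 2 * (2 + εR) ≤ 6 := by linarith
    calc 2 * (2 + εR) * ‖((η : ℂ))⁻¹‖ ^ 2 * d * εR = (2 * (2 + εR)) * (‖((η : ℂ))⁻¹‖ ^ 2 * d * εR) := by ring
      _ ≤ 6 * (‖((η : ℂ))⁻¹‖ ^ 2 * d * (KR * (ε + ρ' + δQ))) :=
          mul_le_mul h1 (mul_le_mul_of_nonneg_left hεRt (by positivity)) (by positivity) (by norm_num)
      _ = 6 * ‖((η : ℂ))⁻¹‖ ^ 2 * d * KR * (ε + ρ' + δQ) := by ring
  have hM16 : 4 * (1 + εR) ^ 2 * ‖((η : ℂ))⁻¹‖ ^ 2 * d ≤ 16 * ‖((η : ℂ))⁻¹‖ ^ 2 * d := by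
    have h1 : (1 + εR) ^ 2 ≤ 4 := by
      calc (1 + εR) ^ 2 ≤ 2 ^ 2 := pow_le_pow_left₀ (by positivity) (by linarith) 2
        _ = 4 := by norm_num
    calc 4 * (1 + εR) ^ 2 * ‖((η : ℂ))⁻¹‖ ^ 2 * d = (1 + εR) ^ 2 * (4 * ‖((η : ℂ))⁻¹‖ ^ 2 * d) := by ring
      _ ≤ 4 * (4 * ‖((η : ℂ))⁻¹‖ ^ 2 * d) := mul_le_mul_of_nonneg_right h1 (by positivity)
      _ = 16 * ‖((η : ℂ))⁻¹‖ ^ 2 * d := by ring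
  have hMρ : 4 * (1 + εR) ^ 2 * ‖((η : ℂ))⁻¹‖ ^ 2 * d * ρ ≤ 16 * ‖((η : ℂ))⁻¹‖ ^ 2 * d * CS * (ε + ρ' + δQ) :=
    calc 4 * (1 + εR) ^ 2 * ‖((η : ℂ))⁻¹‖ ^ 2 * d * ρ ≤ 16 * ‖((η : ℂ))⁻¹‖ ^ 2 * d * ρ := mul_le_mul_of_nonneg_right hM16 hρ0
      _ ≤ 16 * ‖((η : ℂ))⁻¹‖ ^ 2 * d * (CS * (ε + ρ' + δQ)) := mul_le_mul_of_nonneg_left hρt (by positivity)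
      _ = 16 * ‖((η : ℂ))⁻¹‖ ^ 2 * d * CS * (ε + ρ' + δQ) := by ring
  have hμρ : μ * ρ ≤ μ * CS * (ε + ρ' + δQ) := by
    rw [mul_assoc]; exact mul_le_mul_of_nonneg_left hρt hμ.le
  have hBt : B * (ε + ρ' + δQ) ≤ μ / 2 := mul_le_half_of_le_div hB hμ.le ht2
  have hsum : μ * ρ + (2 * (2 + εR) * ‖((η : ℂ))⁻¹‖ ^ 2 * d * εR + 4 * (1 + εR) ^ 2 * ‖((η : ℂ))⁻¹‖ ^ 2 * d * ρ) ≤ μ / 2 := by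
    have : μ * CS * (ε + ρ' + δQ) + (6 * ‖((η : ℂ))⁻¹‖ ^ 2 * d * KR * (ε + ρ' + δQ) + 16 * ‖((η : ℂ))⁻¹‖ ^ 2 * d * CS * (ε + ρ' + δQ)) = B * (ε + ρ' + δQ) := by
      rw [hBdef]; ring
    linarith [hμρ, hεΔ, hMρ]
  have hrew : μ * (1 - ρ) - (2 * (2 + εR) * ‖((η : ℂ))⁻¹‖ ^ 2 * d * εR + 4 * (1 + εR) ^ 2 * ‖((η : ℂ))⁻¹‖ ^ 2 * d * ρ) =
      μ - (μ * ρ + (2 * (2 + εR) * ‖((η : ℂ))⁻¹‖ ^ 2 * d * εR + 4 * (1 + εR) ^ 2 * ‖((η : ℂ))⁻¹‖ ^ 2 * d * ρ)) := by ring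
  have hν2 : μ / 2 ≤ μ * (1 - ρ) - (2 * (2 + εR) * ‖((η : ℂ))⁻¹‖ ^ 2 * d * εR + 4 * (1 + εR) ^ 2 * ‖((η : ℂ))⁻¹‖ ^ 2 * d * ρ) := by
    rw [hrew]; linarith
  have hν : 0 < μ * (1 - ρ) - (2 * (2 + εR) * ‖((η : ℂ))⁻¹‖ ^ 2 * d * εR + 4 * (1 + εR) ^ 2 * ‖((η : ℂ))⁻¹‖ ^ 2 * d * ρ) :=
    lt_of_lt_of_le (by positivity) hν2
  -- the `R`-remainder: `δR ≤ 4(εΔ + Mρ)/μ ≤ 4(6nc²dK_R + 16nc²dC_S)t/μ`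
  have hδR : 2 * (2 * (2 + εR) * ‖((η : ℂ))⁻¹‖ ^ 2 * d * εR + 4 * (1 + εR) ^ 2 * ‖((η : ℂ))⁻¹‖ ^ 2 * d * ρ) /
      (μ * (1 - ρ) - (2 * (2 + εR) * ‖((η : ℂ))⁻¹‖ ^ 2 * d * εR + 4 * (1 + εR) ^ 2 * ‖((η : ℂ))⁻¹‖ ^ 2 * d * ρ)) ≤
      4 * (6 * ‖((η : ℂ))⁻¹‖ ^ 2 * d * KR + 16 * ‖((η : ℂ))⁻¹‖ ^ 2 * d * CS) * (ε + ρ' + δQ) / μ := by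
    have hnum : 0 ≤ 2 * (2 * (2 + εR) * ‖((η : ℂ))⁻¹‖ ^ 2 * d * εR + 4 * (1 + εR) ^ 2 * ‖((η : ℂ))⁻¹‖ ^ 2 * d * ρ) := by positivity
    calc _ ≤ 2 * (2 * (2 + εR) * ‖((η : ℂ))⁻¹‖ ^ 2 * d * εR + 4 * (1 + εR) ^ 2 * ‖((η : ℂ))⁻¹‖ ^ 2 * d * ρ) / (μ / 2) :=
          div_le_div_of_nonneg_left hnum (by positivity) hν2
      _ = 4 * (2 * (2 + εR) * ‖((η : ℂ))⁻¹‖ ^ 2 * d * εR + 4 * (1 + εR) ^ 2 * ‖((η : ℂ))⁻¹‖ ^ 2 * d * ρ) / μ := by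
          field_simp; ring
      _ ≤ 4 * (6 * ‖((η : ℂ))⁻¹‖ ^ 2 * d * KR * (ε + ρ' + δQ) + 16 * ‖((η : ℂ))⁻¹‖ ^ 2 * d * CS * (ε + ρ' + δQ)) / μ := by
          gcongr
      _ = 4 * (6 * ‖((η : ℂ))⁻¹‖ ^ 2 * d * KR + 16 * ‖((η : ℂ))⁻¹‖ ^ 2 * d * CS) * (ε + ρ' + δQ) / μ := by ring
  -- the four pieces of the remainder constant against `K·t`
  have hP' : 16 * d * (2 + εR) * ‖((η : ℂ))⁻¹‖ ^ 2 * εR ≤ 48 * d * ‖((η : ℂ))⁻¹‖ ^ 2 * KR * (ε + ρ' + δQ) := by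
    have h1 : 2 + εR ≤ 3 := by linarith
    calc 16 * d * (2 + εR) * ‖((η : ℂ))⁻¹‖ ^ 2 * εR = (16 * d * ‖((η : ℂ))⁻¹‖ ^ 2) * ((2 + εR) * εR) := by ring
      _ ≤ (16 * d * ‖((η : ℂ))⁻¹‖ ^ 2) * (3 * (KR * (ε + ρ' + δQ))) :=
          mul_le_mul_of_nonneg_left (mul_le_mul h1 hεRt hεR (by norm_num)) (by positivity)
      _ = 48 * d * ‖((η : ℂ))⁻¹‖ ^ 2 * KR * (ε + ρ' + δQ) := by ring
  have hD' : 2 * (2 * (1 + εR) * ‖((η : ℂ))⁻¹‖ * Real.sqrt d) * (‖((η : ℂ))⁻¹‖ * εR * Real.sqrt d) ≤ 8 * ‖((η : ℂ))⁻¹‖ ^ 2 * d * KR * (ε + ρ' + δQ) := by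
    have h1 : 1 + εR ≤ 2 := by linarith
    calc 2 * (2 * (1 + εR) * ‖((η : ℂ))⁻¹‖ * Real.sqrt d) * (‖((η : ℂ))⁻¹‖ * εR * Real.sqrt d) = 4 * ‖((η : ℂ))⁻¹‖ ^ 2 * (Real.sqrt d * Real.sqrt d) * ((1 + εR) * εR) := by ring
      _ = 4 * ‖((η : ℂ))⁻¹‖ ^ 2 * d * ((1 + εR) * εR) := by rw [hsd]
      _ ≤ 4 * ‖((η : ℂ))⁻¹‖ ^ 2 * d * (2 * (KR * (ε + ρ' + δQ))) :=
          mul_le_mul_of_nonneg_left (mul_le_mul h1 hεRt hεR (by norm_num)) (by positivity)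
      _ = 8 * ‖((η : ℂ))⁻¹‖ ^ 2 * d * KR * (ε + ρ' + δQ) := by ring
  have hR' : (2 * (1 + εR) * ‖((η : ℂ))⁻¹‖ * Real.sqrt d) ^ 2 *
      (2 * (2 * (2 + εR) * ‖((η : ℂ))⁻¹‖ ^ 2 * d * εR + 4 * (1 + εR) ^ 2 * ‖((η : ℂ))⁻¹‖ ^ 2 * d * ρ) /
        (μ * (1 - ρ) - (2 * (2 + εR) * ‖((η : ℂ))⁻¹‖ ^ 2 * d * εR + 4 * (1 + εR) ^ 2 * ‖((η : ℂ))⁻¹‖ ^ 2 * d * ρ))) ≤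
      64 * ‖((η : ℂ))⁻¹‖ ^ 2 * d * (6 * ‖((η : ℂ))⁻¹‖ ^ 2 * d * KR + 16 * ‖((η : ℂ))⁻¹‖ ^ 2 * d * CS) / μ * (ε + ρ' + δQ) := by
    have hsq : (2 * (1 + εR) * ‖((η : ℂ))⁻¹‖ * Real.sqrt d) ^ 2 = 4 * (1 + εR) ^ 2 * ‖((η : ℂ))⁻¹‖ ^ 2 * d := by
      rw [show (2 * (1 + εR) * ‖((η : ℂ))⁻¹‖ * Real.sqrt d) ^ 2 = 4 * (1 + εR) ^ 2 * ‖((η : ℂ))⁻¹‖ ^ 2 * (Real.sqrt d * Real.sqrt d) by ring, hsd]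
    rw [hsq]
    have hδR0 : 0 ≤ 2 * (2 * (2 + εR) * ‖((η : ℂ))⁻¹‖ ^ 2 * d * εR + 4 * (1 + εR) ^ 2 * ‖((η : ℂ))⁻¹‖ ^ 2 * d * ρ) /
        (μ * (1 - ρ) - (2 * (2 + εR) * ‖((η : ℂ))⁻¹‖ ^ 2 * d * εR + 4 * (1 + εR) ^ 2 * ‖((η : ℂ))⁻¹‖ ^ 2 * d * ρ)) := div_nonneg (by positivity) hν.le
    calc 4 * (1 + εR) ^ 2 * ‖((η : ℂ))⁻¹‖ ^ 2 * d * (2 * (2 * (2 + εR) * ‖((η : ℂ))⁻¹‖ ^ 2 * d * εR + 4 * (1 + εR) ^ 2 * ‖((η : ℂ))⁻¹‖ ^ 2 * d * ρ) /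
          (μ * (1 - ρ) - (2 * (2 + εR) * ‖((η : ℂ))⁻¹‖ ^ 2 * d * εR + 4 * (1 + εR) ^ 2 * ‖((η : ℂ))⁻¹‖ ^ 2 * d * ρ)))
        ≤ 16 * ‖((η : ℂ))⁻¹‖ ^ 2 * d * (4 * (6 * ‖((η : ℂ))⁻¹‖ ^ 2 * d * KR + 16 * ‖((η : ℂ))⁻¹‖ ^ 2 * d * CS) * (ε + ρ' + δQ) / μ) :=
          mul_le_mul hM16 hδR hδR0 (by positivity)
      _ = 64 * ‖((η : ℂ))⁻¹‖ ^ 2 * d * (6 * ‖((η : ℂ))⁻¹‖ ^ 2 * d * KR + 16 * ‖((η : ℂ))⁻¹‖ ^ 2 * d * CS) / μ * (ε + ρ' + δQ) := by ring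
  have hQ'' : |a| * δQ * (2 * MQ + δQ) ≤ |a| * (2 * MQ + 1) * (ε + ρ' + δQ) := by
    have h1 : 2 * MQ + δQ ≤ 2 * MQ + 1 := by linarith
    calc |a| * δQ * (2 * MQ + δQ) = |a| * (δQ * (2 * MQ + δQ)) := by ring
      _ ≤ |a| * ((ε + ρ' + δQ) * (2 * MQ + 1)) :=
          mul_le_mul_of_nonneg_left (mul_le_mul hδQt h1 (by positivity) (by positivity)) (abs_nonneg a)
      _ = |a| * (2 * MQ + 1) * (ε + ρ' + δQ) := by ring
  have hKt : K * (ε + ρ' + δQ) ≤ γ₀ / 2 := mul_le_half_of_le_div hK hγ₀.le ht3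
  have hδ : 16 * d * (2 + εR) * ‖((η : ℂ))⁻¹‖ ^ 2 * εR
      + 2 * (2 * (1 + εR) * ‖((η : ℂ))⁻¹‖ * Real.sqrt d) * (‖((η : ℂ))⁻¹‖ * εR * Real.sqrt d)
      + (2 * (1 + εR) * ‖((η : ℂ))⁻¹‖ * Real.sqrt d) ^ 2 *
        (2 * (2 * (2 + εR) * ‖((η : ℂ))⁻¹‖ ^ 2 * d * εR + 4 * (1 + εR) ^ 2 * ‖((η : ℂ))⁻¹‖ ^ 2 * d * ρ) /
          (μ * (1 - ρ) - (2 * (2 + εR) * ‖((η : ℂ))⁻¹‖ ^ 2 * d * εR + 4 * (1 + εR) ^ 2 * ‖((η : ℂ))⁻¹‖ ^ 2 * d * ρ)))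
      + |a| * δQ * (2 * MQ + δQ) ≤ γ₀ / 2 := by
    have hKsum : 48 * d * ‖((η : ℂ))⁻¹‖ ^ 2 * KR * (ε + ρ' + δQ) + 8 * ‖((η : ℂ))⁻¹‖ ^ 2 * d * KR * (ε + ρ' + δQ)
        + 64 * ‖((η : ℂ))⁻¹‖ ^ 2 * d * (6 * ‖((η : ℂ))⁻¹‖ ^ 2 * d * KR + 16 * ‖((η : ℂ))⁻¹‖ ^ 2 * d * CS) / μ * (ε + ρ' + δQ) + |a| * (2 * MQ + 1) * (ε + ρ' + δQ)
        = K * (ε + ρ' + δQ) := by rw [hKdef]; ring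
    calc _ ≤ 48 * d * ‖((η : ℂ))⁻¹‖ ^ 2 * KR * (ε + ρ' + δQ) + 8 * ‖((η : ℂ))⁻¹‖ ^ 2 * d * KR * (ε + ρ' + δQ)
        + 64 * ‖((η : ℂ))⁻¹‖ ^ 2 * d * (6 * ‖((η : ℂ))⁻¹‖ ^ 2 * d * KR + 16 * ‖((η : ℂ))⁻¹‖ ^ 2 * d * CS) / μ * (ε + ρ' + δQ)
        + |a| * (2 * MQ + 1) * (ε + ρ' + δQ) := add_le_add (add_le_add (add_le_add hP' hD') hR') hQ''
      _ = K * (ε + ρ' + δQ) := hKsum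
      _ ≤ γ₀ / 2 := hKt
  -- conclusion: `γ₀ − γ₀/2 = γ₀/2`
  have h := coercive_of_sub_le (δ := γ₀ / 2) hflat (fun y =>
    (norm_principalGFk_sub_flat_le L m n hL φ η a U α hα1 hU1 hreg hεR hρ0 hδQ hMQ hμ hR hRS hmod S₁ S₂ hS₁ hS₂ hρ₁ hρ₂ hQ hQ₁ hν y).trans
      (mul_le_mul_of_nonneg_right hδ (norm_nonneg _))) x
  have h2 : γ₀ / 2 = γ₀ - γ₀ / 2 := by ring
  rw [h2]
  exact h

end SmallField

/-! ## §4 [B9] Thm 3.11 for the `k`-level operator `Δ_a(U)` (with the curvature part) at every small field -/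

section Hpos

open B9Eq310DeltaPrime (plaqHolU)
open B9Eq315QTorusOnto (liftSite perSite_liftSite)
open B9Eq326OperatorTower (laplaceAk)
open B9Ineq369CurvatureSmall (hpos_of_smallCurvature)
open B9Thm311SmallFieldClosed (norm_plaqHolU_sub_one_le hRS_of_unitary)

variable [StarRing 𝔸] [NormedStarGroup 𝔸] [StarModule ℂ 𝔸] (α : ℕ → ℝ) (hα1 : ∀ j, α j ≤ 1 / 64)

/-- **[B9] THM 3.11 «Δ_a IS POSITIVE DEFINITE» FOR THE `k`-LEVEL OPERATOR `laplaceAk` AT EVERY SMALL FIELD OF A FIXED LATTICE, modulo the displayed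
tower averaging letters**: for every `CS ≥ 0` there is `ε₀ > 0` (a finite-lattice number) such that for EVERY background `U` of the tower's data with
`U(b) ∈ U1`, `‖U(b) − 1‖ ≤ ε`, `hRS`, right inverses `S₁`/`S₂` of `Q′_k(1)`/`Q′_k(U)` bounded by `CS`, `‖Q′_k(U)λ − Q′_k(1)λ‖_∞ ≤ ρ′‖λ‖`,
`‖Q_k(U)x − Q_k(1)x‖ ≤ δ_Q‖x‖` and `ε + ρ′ + δ_Q ≤ ε₀`, the DISPLAYED `hpos` of `B9Eq326OperatorTower.G1k ∕ H1k ∕ frakGk` HOLDS: `0 < re⟨x, Δ_a^{(k)}(U)x⟩`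
for `x ≠ 0` — §3's coercivity of the principal part + the smallness of the fine-lattice curvature part `Δ′(U)` (`hpos_of_smallCurvature`, plaquettes
`4ε`-close to `1`).  NOT print's uniform statement. [cite: Balaban1985BackgroundPropagators, Thm 3.11 p.416, (3.69) p.404, (3.82)–(3.86) p.407, (3.26) p.395] -/
theorem laplaceAk_pos_of_small_field {η : ℝ} (hη : η ≠ 0) {a : ℝ} (ha : 0 < a) {Mφ Mφ' : ℝ} (hMφ : 0 ≤ Mφ) (hMφ' : 0 ≤ Mφ')
    (hφ : ∀ w, ‖φ w‖ ≤ Mφ * ‖w‖) (hφ' : ∀ X, ‖φ.symm X‖ ≤ Mφ' * ‖X‖) (τ : 𝔸 →ₗ[ℂ] ℂ) {Cτ : ℝ} (hτ : ∀ X, ‖τ X‖ ≤ Cτ * ‖X‖) (hCτ : 0 ≤ Cτ)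
    {CS : ℝ} (hCS : 0 ≤ CS) :
    ∃ ε₀ : ℝ, 0 < ε₀ ∧ ∀ (U : Bond d (towerP L m (n + 1)) → 𝔸ˣ)
      (hU1 : ∀ (j : ℕ) (x : B7Prop1Explicit.Site d) (κ : Fin d), perCfg (towerP L m (j + 1)) (UlevOf L m (n + 1) U j) x κ ∈ U1 𝔸)
      (hreg : ∀ (j : ℕ) (y : TSite d (towerP L m j)) (κ : Fin d) (r : Fin d → Fin L),
        ‖((Wcx L (perCfg (towerP L m (j + 1)) (UlevOf L m (n + 1) U j)) (cornerSite L y) κ (boxVec L r) : 𝔸ˣ) : 𝔸) - 1‖ ≤ α j)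
      (S₁ S₂ : (TSite d m → W) →ₗ[ℂ] SiteL2K ℂ d (towerP L m (n + 1)) c₀ W)
      {ε ρ' δQ : ℝ}, 0 ≤ ε → 0 ≤ ρ' → 0 ≤ δQ → ε + ρ' + δQ ≤ ε₀ →
      (∀ b, U b ∈ U1 𝔸) → (∀ b, ‖(U b : 𝔸) - 1‖ ≤ ε) →
      (∀ (b : Bond d (towerP L m (n + 1))) (v u : W), ⟪adTransportW φ U b v, u⟫_ℂ = ⟪v, adTransportW φ (fun b => (U b)⁻¹) b u⟫_ℂ) →
      (∀ f, QprimeTowerW L m n φ (fun _ : Bond d (towerP L m (n + 1)) => (1 : 𝔸ˣ)) (S₁ f) = f) →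
      (∀ f, QprimeTowerW L m n φ U (S₂ f) = f) → (∀ f, ‖S₁ f‖ ≤ CS * ‖f‖) → (∀ f, ‖S₂ f‖ ≤ CS * ‖f‖) →
      (∀ l : SiteL2K ℂ d (towerP L m (n + 1)) c₀ W,
        ‖QprimeTowerW L m n φ U l - QprimeTowerW L m n φ (fun _ : Bond d (towerP L m (n + 1)) => (1 : 𝔸ˣ)) l‖ ≤ ρ' * ‖l‖) →
      (∀ x : BondL2K ℂ d (towerP L m (n + 1)) c₀ W, ‖QkW L m n φ U hL α hα1 hU1 hreg (c₁ := c₁) x -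
        QkW L m n φ (fun _ : Bond d (towerP L m (n + 1)) => (1 : 𝔸ˣ)) hL (fun _ => 0) (fun _ => by norm_num)
          (perCfg_UlevOf_one_mem_U1 L m (n + 1)) (norm_Wcx_UlevOf_one_sub_one_le L m (n + 1) (fun _ => 0) (fun _ => le_rfl)) (c₁ := c₁) x‖ ≤
        δQ * ‖x‖) →
      ∀ x : BondL2K ℂ d (towerP L m (n + 1)) c₀ W, x ≠ 0 →
        0 < RCLike.re ⟪x, laplaceAk L m n φ η U hL α hα1 hU1 hreg τ (c₀ := c₀) (c₁ := c₁) a x⟫_ℂ := by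
  have hc₀ : 0 < c₀ := Fact.out
  obtain ⟨γ, ε₁, hγ, hε₁, H⟩ := exists_coercive_principalk_of_small_field L m n hL φ (c₀ := c₀) (c₁ := c₁) α hα1 hη ha hMφ hMφ' hφ hφ' hCS
  obtain ⟨Kc, hKcdef⟩ : ∃ Kc : ℝ, Kc = 32 * d * Cτ * Mφ ^ 2 * (|η| ^ d / c₀) * (‖((η : ℂ))⁻¹‖ ^ 2 * 4) := ⟨_, rfl⟩
  have hKc : 0 ≤ Kc := by rw [hKcdef]; positivity
  refine ⟨min ε₁ (γ / (Kc + 1) / 2), by positivity, ?_⟩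
  intro U hU1 hreg S₁ S₂ ε ρ' δQ hε hρ' hδQ ht hUb hUε hRS hS₁ hS₂ hS₁n hS₂n hQ' hQ x hx
  have hUb' : ∀ b : Bond d (towerP L m (n + 1)), ‖(U b : 𝔸)‖ ≤ 1 ∧ ‖(((U b)⁻¹ : 𝔸ˣ) : 𝔸)‖ ≤ 1 := fun b => B7Prop1Explicit.mem_U1.1 (hUb b)
  have hpl : ∀ p : B9SectCLatticeCarrier.Plaq d (towerP L m (n + 1)), ‖(plaqHolU U p : 𝔸) - 1‖ ≤ 4 * ε := norm_plaqHolU_sub_one_le hUb hUε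
  have hγU := H U hU1 hreg S₁ S₂ hε hρ' hδQ (ht.trans (min_le_left _ _)) hUb hUε hRS hS₁ hS₂ hS₁n hS₂n hQ' hQ
  -- the curvature constant `Kc·ε < γ`
  have hεt : ε ≤ γ / (Kc + 1) / 2 := by
    have : ε ≤ ε + ρ' + δQ := by linarith
    exact this.trans (ht.trans (min_le_right _ _))
  have hsmall : 32 * d * Cτ * Mφ ^ 2 * (|η| ^ d / c₀) * (‖((η : ℂ))⁻¹‖ ^ 2 * (4 * ε)) < γ := by
    have h1 : 32 * d * Cτ * Mφ ^ 2 * (|η| ^ d / c₀) * (‖((η : ℂ))⁻¹‖ ^ 2 * (4 * ε)) = Kc * ε := by rw [hKcdef]; ring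
    rw [h1]
    have h3 : Kc * ε ≤ Kc * (γ / (Kc + 1) / 2) := mul_le_mul_of_nonneg_left hεt hKc
    have h4 : Kc * (γ / (Kc + 1) / 2) < γ := by
      rw [mul_div_assoc', mul_div_assoc', div_div, div_lt_iff₀ (by positivity)]
      nlinarith
    exact h3.trans_lt h4
  rw [laplaceAk]
  exact hpos_of_smallCurvature φ hτ hCτ hφ η hUb' hpl (by positivity) _ _ _ _ _ a hγU hsmall x hx

/-- **THE SAME WITH `hRS` DISCHARGED BY THE MODEL LETTERS** (`B9Thm311SmallFieldClosed.hRS_of_unitary`): unitary bond variables, a tracial `τ`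
norming the fibre. [cite: Balaban1985BackgroundPropagators, Thm 3.11 p.416, (3.5) p.391; Balaban1985Averaging, (17)–(18) pp.20–21] -/
theorem laplaceAk_pos_of_small_field_unitary {η : ℝ} (hη : η ≠ 0) {a : ℝ} (ha : 0 < a) {Mφ Mφ' : ℝ} (hMφ : 0 ≤ Mφ) (hMφ' : 0 ≤ Mφ')
    (hφ : ∀ w, ‖φ w‖ ≤ Mφ * ‖w‖) (hφ' : ∀ X, ‖φ.symm X‖ ≤ Mφ' * ‖X‖) (τ : 𝔸 →ₗ[ℂ] ℂ) {Cτ : ℝ} (hτ : ∀ X, ‖τ X‖ ≤ Cτ * ‖X‖) (hCτ : 0 ≤ Cτ)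
    (hτφ : ∀ X Y : 𝔸, ⟪φ.symm X, φ.symm Y⟫_ℂ = τ (star X * Y)) (htr : ∀ X Y : 𝔸, τ (X * Y) = τ (Y * X)) {CS : ℝ} (hCS : 0 ≤ CS) :
    ∃ ε₀ : ℝ, 0 < ε₀ ∧ ∀ (U : Bond d (towerP L m (n + 1)) → 𝔸ˣ)
      (hU1 : ∀ (j : ℕ) (x : B7Prop1Explicit.Site d) (κ : Fin d), perCfg (towerP L m (j + 1)) (UlevOf L m (n + 1) U j) x κ ∈ U1 𝔸)
      (hreg : ∀ (j : ℕ) (y : TSite d (towerP L m j)) (κ : Fin d) (r : Fin d → Fin L),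
        ‖((Wcx L (perCfg (towerP L m (j + 1)) (UlevOf L m (n + 1) U j)) (cornerSite L y) κ (boxVec L r) : 𝔸ˣ) : 𝔸) - 1‖ ≤ α j)
      (S₁ S₂ : (TSite d m → W) →ₗ[ℂ] SiteL2K ℂ d (towerP L m (n + 1)) c₀ W)
      {ε ρ' δQ : ℝ}, 0 ≤ ε → 0 ≤ ρ' → 0 ≤ δQ → ε + ρ' + δQ ≤ ε₀ →
      (∀ b, U b ∈ U1 𝔸) → (∀ b, ‖(U b : 𝔸) - 1‖ ≤ ε) → (∀ b, star (U b : 𝔸) = (((U b)⁻¹ : 𝔸ˣ) : 𝔸)) →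
      (∀ f, QprimeTowerW L m n φ (fun _ : Bond d (towerP L m (n + 1)) => (1 : 𝔸ˣ)) (S₁ f) = f) →
      (∀ f, QprimeTowerW L m n φ U (S₂ f) = f) → (∀ f, ‖S₁ f‖ ≤ CS * ‖f‖) → (∀ f, ‖S₂ f‖ ≤ CS * ‖f‖) →
      (∀ l : SiteL2K ℂ d (towerP L m (n + 1)) c₀ W,
        ‖QprimeTowerW L m n φ U l - QprimeTowerW L m n φ (fun _ : Bond d (towerP L m (n + 1)) => (1 : 𝔸ˣ)) l‖ ≤ ρ' * ‖l‖) →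
      (∀ x : BondL2K ℂ d (towerP L m (n + 1)) c₀ W, ‖QkW L m n φ U hL α hα1 hU1 hreg (c₁ := c₁) x -
        QkW L m n φ (fun _ : Bond d (towerP L m (n + 1)) => (1 : 𝔸ˣ)) hL (fun _ => 0) (fun _ => by norm_num)
          (perCfg_UlevOf_one_mem_U1 L m (n + 1)) (norm_Wcx_UlevOf_one_sub_one_le L m (n + 1) (fun _ => 0) (fun _ => le_rfl)) (c₁ := c₁) x‖ ≤
        δQ * ‖x‖) →
      ∀ x : BondL2K ℂ d (towerP L m (n + 1)) c₀ W, x ≠ 0 →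
        0 < RCLike.re ⟪x, laplaceAk L m n φ η U hL α hα1 hU1 hreg τ (c₀ := c₀) (c₁ := c₁) a x⟫_ℂ := by
  obtain ⟨ε₀, hε₀, H⟩ := laplaceAk_pos_of_small_field L m n hL φ (c₀ := c₀) (c₁ := c₁) α hα1 hη ha hMφ hMφ' hφ hφ' τ hτ hCτ hCS
  exact ⟨ε₀, hε₀, fun U hU1 hreg S₁ S₂ ε ρ' δQ hε hρ' hδQ ht hUb hUε hUstar hS₁ hS₂ hS₁n hS₂n hQ' hQ x hx =>
    H U hU1 hreg S₁ S₂ hε hρ' hδQ ht hUb hUε (hRS_of_unitary φ τ hτφ htr U hUstar) hS₁ hS₂ hS₁n hS₂n hQ' hQ x hx⟩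

end Hpos

/-! ## §5 The sections `(S₁, S₂, CS)` DISCHARGED by the universal right inverse of `Q′_k` (APPEND v1.1, NE9 leaf-02 gen 63) -/

section SectionsFree

open B9Eq326OperatorTower (laplaceAk)
open B9Eq319QprimeTowerCentre (exists_QprimeTowerW_rightInverse)

variable [StarRing 𝔸] [NormedStarGroup 𝔸] [StarModule ℂ 𝔸] (α : ℕ → ℝ) (hα1 : ∀ j, α j ≤ 1 / 64)

/-- **[B9] THM 3.11 «Δ_a IS POSITIVE DEFINITE» FOR THE `k`-LEVEL OPERATOR `laplaceAk` AT EVERY SMALL FIELD OF A FIXED LATTICE, modulo the tower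
averaging letters `ρ′`, `δ_Q` ONLY** — §4's `laplaceAk_pos_of_small_field` with the right-inverse binders `(S₁ S₂ …)`, `hS₁ hS₂ hS₁n hS₂n` and the
parameter `CS` DISCHARGED by the universal section of `B9Eq319QprimeTowerCentre.exists_QprimeTowerW_rightInverse` (one `φ`∕`U`-free linear `S`
with `Q′_k(U) ∘ S = id`; `S₁ = S₂ = S`, `CS := (L^d)^{n+1}·√(c₀·#T_m)` fixed BEFORE `∃ ε₀`, so `ε₀` is still a finite-lattice number).  NOT print's
uniform statement. [folklore composition BY NAME] [cite: Balaban1985BackgroundPropagators, Thm 3.11 p.416, (3.15)/(3.19) p.393, (3.82)–(3.86) p.407] -/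
theorem laplaceAk_pos_of_small_field' {η : ℝ} (hη : η ≠ 0) {a : ℝ} (ha : 0 < a) {Mφ Mφ' : ℝ} (hMφ : 0 ≤ Mφ) (hMφ' : 0 ≤ Mφ')
    (hφ : ∀ w, ‖φ w‖ ≤ Mφ * ‖w‖) (hφ' : ∀ X, ‖φ.symm X‖ ≤ Mφ' * ‖X‖) (τ : 𝔸 →ₗ[ℂ] ℂ) {Cτ : ℝ} (hτ : ∀ X, ‖τ X‖ ≤ Cτ * ‖X‖) (hCτ : 0 ≤ Cτ) :
    ∃ ε₀ : ℝ, 0 < ε₀ ∧ ∀ (U : Bond d (towerP L m (n + 1)) → 𝔸ˣ)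
      (hU1 : ∀ (j : ℕ) (x : B7Prop1Explicit.Site d) (κ : Fin d), perCfg (towerP L m (j + 1)) (UlevOf L m (n + 1) U j) x κ ∈ U1 𝔸)
      (hreg : ∀ (j : ℕ) (y : TSite d (towerP L m j)) (κ : Fin d) (r : Fin d → Fin L),
        ‖((Wcx L (perCfg (towerP L m (j + 1)) (UlevOf L m (n + 1) U j)) (cornerSite L y) κ (boxVec L r) : 𝔸ˣ) : 𝔸) - 1‖ ≤ α j)
      {ε ρ' δQ : ℝ}, 0 ≤ ε → 0 ≤ ρ' → 0 ≤ δQ → ε + ρ' + δQ ≤ ε₀ →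
      (∀ b, U b ∈ U1 𝔸) → (∀ b, ‖(U b : 𝔸) - 1‖ ≤ ε) →
      (∀ (b : Bond d (towerP L m (n + 1))) (v u : W), ⟪adTransportW φ U b v, u⟫_ℂ = ⟪v, adTransportW φ (fun b => (U b)⁻¹) b u⟫_ℂ) →
      (∀ l : SiteL2K ℂ d (towerP L m (n + 1)) c₀ W,
        ‖QprimeTowerW L m n φ U l - QprimeTowerW L m n φ (fun _ : Bond d (towerP L m (n + 1)) => (1 : 𝔸ˣ)) l‖ ≤ ρ' * ‖l‖) →
      (∀ x : BondL2K ℂ d (towerP L m (n + 1)) c₀ W, ‖QkW L m n φ U hL α hα1 hU1 hreg (c₁ := c₁) x -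
        QkW L m n φ (fun _ : Bond d (towerP L m (n + 1)) => (1 : 𝔸ˣ)) hL (fun _ => 0) (fun _ => by norm_num)
          (perCfg_UlevOf_one_mem_U1 L m (n + 1)) (norm_Wcx_UlevOf_one_sub_one_le L m (n + 1) (fun _ => 0) (fun _ => le_rfl)) (c₁ := c₁) x‖ ≤
        δQ * ‖x‖) →
      ∀ x : BondL2K ℂ d (towerP L m (n + 1)) c₀ W, x ≠ 0 →
        0 < RCLike.re ⟪x, laplaceAk L m n φ η U hL α hα1 hU1 hreg τ (c₀ := c₀) (c₁ := c₁) a x⟫_ℂ := by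
  obtain ⟨S, hS, -, hSn⟩ := exists_QprimeTowerW_rightInverse L m n (𝔸 := 𝔸) (W := W) (c₀ := c₀)
  have hCS : (0 : ℝ) ≤ ((L : ℝ) ^ d) ^ (n + 1) * Real.sqrt (c₀ * Fintype.card (TSite d m)) := by positivity
  obtain ⟨ε₀, hε₀, H⟩ := laplaceAk_pos_of_small_field L m n hL φ (c₀ := c₀) (c₁ := c₁) α hα1 hη ha hMφ hMφ' hφ hφ' τ hτ hCτ hCS
  exact ⟨ε₀, hε₀, fun U hU1 hreg ε ρ' δQ hε hρ' hδQ ht hUb hUε hRS hQ' hQ x hx =>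
    H U hU1 hreg S S hε hρ' hδQ ht hUb hUε hRS (hS φ _) (hS φ U) hSn hSn hQ' hQ x hx⟩

/-- **THE SAME WITH `hRS` DISCHARGED BY THE MODEL LETTERS AND THE SECTIONS DISCHARGED** — §4's `laplaceAk_pos_of_small_field_unitary` without
`(S₁ S₂ …) hS₁ hS₂ hS₁n hS₂n` and `CS`: unitary bond variables, a tracial `τ` norming the fibre; displays left `ρ′`, `δ_Q` only.
[folklore composition BY NAME] [cite: Balaban1985BackgroundPropagators, Thm 3.11 p.416, (3.5) p.391, (3.15)/(3.19) p.393; Balaban1985Averaging, (17)–(18) pp.20–21] -/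
theorem laplaceAk_pos_of_small_field_unitary' {η : ℝ} (hη : η ≠ 0) {a : ℝ} (ha : 0 < a) {Mφ Mφ' : ℝ} (hMφ : 0 ≤ Mφ) (hMφ' : 0 ≤ Mφ')
    (hφ : ∀ w, ‖φ w‖ ≤ Mφ * ‖w‖) (hφ' : ∀ X, ‖φ.symm X‖ ≤ Mφ' * ‖X‖) (τ : 𝔸 →ₗ[ℂ] ℂ) {Cτ : ℝ} (hτ : ∀ X, ‖τ X‖ ≤ Cτ * ‖X‖) (hCτ : 0 ≤ Cτ)
    (hτφ : ∀ X Y : 𝔸, ⟪φ.symm X, φ.symm Y⟫_ℂ = τ (star X * Y)) (htr : ∀ X Y : 𝔸, τ (X * Y) = τ (Y * X)) :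
    ∃ ε₀ : ℝ, 0 < ε₀ ∧ ∀ (U : Bond d (towerP L m (n + 1)) → 𝔸ˣ)
      (hU1 : ∀ (j : ℕ) (x : B7Prop1Explicit.Site d) (κ : Fin d), perCfg (towerP L m (j + 1)) (UlevOf L m (n + 1) U j) x κ ∈ U1 𝔸)
      (hreg : ∀ (j : ℕ) (y : TSite d (towerP L m j)) (κ : Fin d) (r : Fin d → Fin L),
        ‖((Wcx L (perCfg (towerP L m (j + 1)) (UlevOf L m (n + 1) U j)) (cornerSite L y) κ (boxVec L r) : 𝔸ˣ) : 𝔸) - 1‖ ≤ α j)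
      {ε ρ' δQ : ℝ}, 0 ≤ ε → 0 ≤ ρ' → 0 ≤ δQ → ε + ρ' + δQ ≤ ε₀ →
      (∀ b, U b ∈ U1 𝔸) → (∀ b, ‖(U b : 𝔸) - 1‖ ≤ ε) → (∀ b, star (U b : 𝔸) = (((U b)⁻¹ : 𝔸ˣ) : 𝔸)) →
      (∀ l : SiteL2K ℂ d (towerP L m (n + 1)) c₀ W,
        ‖QprimeTowerW L m n φ U l - QprimeTowerW L m n φ (fun _ : Bond d (towerP L m (n + 1)) => (1 : 𝔸ˣ)) l‖ ≤ ρ' * ‖l‖) →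
      (∀ x : BondL2K ℂ d (towerP L m (n + 1)) c₀ W, ‖QkW L m n φ U hL α hα1 hU1 hreg (c₁ := c₁) x -
        QkW L m n φ (fun _ : Bond d (towerP L m (n + 1)) => (1 : 𝔸ˣ)) hL (fun _ => 0) (fun _ => by norm_num)
          (perCfg_UlevOf_one_mem_U1 L m (n + 1)) (norm_Wcx_UlevOf_one_sub_one_le L m (n + 1) (fun _ => 0) (fun _ => le_rfl)) (c₁ := c₁) x‖ ≤
        δQ * ‖x‖) →
      ∀ x : BondL2K ℂ d (towerP L m (n + 1)) c₀ W, x ≠ 0 →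
        0 < RCLike.re ⟪x, laplaceAk L m n φ η U hL α hα1 hU1 hreg τ (c₀ := c₀) (c₁ := c₁) a x⟫_ℂ := by
  obtain ⟨S, hS, -, hSn⟩ := exists_QprimeTowerW_rightInverse L m n (𝔸 := 𝔸) (W := W) (c₀ := c₀)
  have hCS : (0 : ℝ) ≤ ((L : ℝ) ^ d) ^ (n + 1) * Real.sqrt (c₀ * Fintype.card (TSite d m)) := by positivity
  obtain ⟨ε₀, hε₀, H⟩ :=
    laplaceAk_pos_of_small_field_unitary L m n hL φ (c₀ := c₀) (c₁ := c₁) α hα1 hη ha hMφ hMφ' hφ hφ' τ hτ hCτ hτφ htr hCS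
  exact ⟨ε₀, hε₀, fun U hU1 hreg ε ρ' δQ hε hρ' hδQ ht hUb hUε hUstar hQ' hQ x hx =>
    H U hU1 hreg S S hε hρ' hδQ ht hUb hUε hUstar (hS φ _) (hS φ U) hSn hSn hQ' hQ x hx⟩

end SectionsFree

end Literature.MathematicalPhysics.QuantumFieldTheory.Balaban1983to89.B9Thm311SmallFieldCoercivityTower

end
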